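import Literature.MathematicalPhysics.QuantumFieldTheory.Balaban1983to89.T4BareCouplingChart

/-!
# `Balaban1983to89.T4OneLoopAsymptotics` — NE4 (node U2): the universal one-loop asymptotics of the tuned BARE
# coupling (ε → 0) and of the CONTINUUM running coupling (deep ultraviolet), from the printed one-loop split with the
# β sub-cell's (AF-0)/(AF-1) and node U2's asymptotic-freedom / rate shapes as NAMED BINDERS

Cell `pub-balaban`, T⁴ programme (T4-DAG node U2, spine estimate NE4 = the η-rate of the FULL β-functions, booked as
β¹-half + β⁰-half; unit `b2b-balaban-t4-ne4-p2`, technique P2 "two-trajectory comparison", generation 9; journal row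
T4-U2.NE4-PROVE-P2i*).  Companion record `run/shared/lean/pub/pub-balaban/t4/T4-EST-NE4-P2.md` v1.11 §18 (v1.12 §19 for the
sequel `T4TwoLoopLaw`).  v1.1 (same generation): HEADER-ONLY DOCFIX answering the XREAD of v1 (GAPS C-adv4-108, D1/D2):
the p. 259 Theorem-2 quotation now reads "constants β, β′, 0 < β ≦ β′" as printed (v1 wrote "β, β₁"), and the p. 255
sentence is quoted to its end; every declaration byte-identical to v1.

HONEST FRAMING.  Rung (B)+1 on a FIXED four-torus; statements about COUPLING CONSTANTS only (the scalar backward problem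
of [Balaban1987RG1] (0.20) and its ε → 0 limit), NOT about expectations of observables, NOT existence or uniqueness of
the continuum limit of the MEASURES, NOT infinite volume, NOT a mass gap, NOT the Clay problem, NOT summit progress.
Every β-side input below is a NAMED BINDER (a displayed hypothesis), NOT PRINTED for Bałaban's β-functions: the one-loop
LIMIT (AF-0) `β⁰_k → β⁰_∞` / its rate form (AF-0r) `|β⁰_k − β⁰_∞| ≤ c₀θ₀^k` and the remainder bound (AF-1)
`|β¹_{k+1}(p)| ≤ C₁·p_k` (cell MISSING-B12.md (M1)/(M2), GAPS G-b12-1, G-b12-2 — [Balaban1989LargeFieldII] p. 355: "The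
proof of Theorem 2, which is based on second order perturbative calculations, […] has not been published yet"), node
U2's eventual lower bound `T4CouplingMatching.EventualLowerH b γ k₀ β` (`b > 0`) and — for the continuum half — NE4's
OUTPUT shape `T4CauchySum.InjectedRate C 0 θ (disc …)` together with run-wise (0.20) `RGEqH`, the box and the pin (GAPS
G-t4-U2-1, G-t4-U2-2, G-t4-U2R-2).  The module proves [folklore] real analysis (finite sums, `Σ_{j≤n} j^{−1/2} ≤ 2√n`,
Cesàro) OVER those binders; the ONLY printed ingredient is the SHAPE of the one-loop split
`β_{k+1} = β⁰_{k+1} + β¹_{k+1}` (`B12Beta.OneLoopSplit`, bookkeeping on [Balaban1987RG1] (1.3)/(1.6) pp. 260–261 and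
(2.12)–(2.14) p. 268).  The wall of node U2 — the two-history Lipschitz modulus (M) of the one-step map of
[Balaban1988RG2Cluster] (2.12)/(2.13), NOT PRINTED — is neither used nor touched.

WHAT PRINT SAYS (located, quoted from the renders; nothing of it is asserted here).  [Balaban1987RG1] p. 255, after (0.18):
"The equation (0.18) written in the form (1/g₁²) − (1/g₀²) = (d(1/g²))₀ = −β₁(g₀) is a finite difference approximation,
corresponding to two consecutive lattice spacings (on a logarithmic scale) of the differential equation (d/ds)(1/g²) =
−β(g), or (dg/ds) = ½β(g)g³. This is the usual differential renormalization group equation, an example of a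
Callan-Symanzik equation, considered in quantum field theory."  Ibid. p. 259, Theorem 2: "there exists a bare coupling
constant g₀ = g₀(ε, g) such that the sequence of the effective coupling constants g_k is contained in the interval ]0,γ],
and g_K = g. Moreover, there exist constants β, β′, 0 < β ≦ β′, such that g_k satisfy the inequality (0.31)" (wording of
the constants read off the page IMAGE `…-p011-x2.png`; the text layer garbles β′) — the two-sided LINEAR envelope
`1/g_K² + β(K−k) ≤ 1/g_k² ≤ 1/g_K² + β′(K−k)` (tree: `FlowStep.discrete031_of_trajBounds`) — and then: "A proof of this
theorem, based on perturbative calculations, will be given in a separate paper, where more precise asymptotic behavior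
will be proved."  That more precise behaviour is what this module TYPES, conditionally: the leading coefficient of
`1/g₀(ε,g)²` in `log_L(1/ε) = K` is the k → ∞ limit `β⁰_∞` of the COUPLING-FREE one-loop coefficients, the same for every
renormalized `g ∈ ]0,γ]`, with an error of the size the remainder bound allows (`O(√K)` under the linear (AF-1); `O(log K)`
under a quadratic remainder bound, §5).  Textbook NEIGHBOUR of the shape (used by NO declaration): [Creutz2022] (M. Creutz,
Quarks, Gluons and Lattices, CUP), ch. 13 "Asymptotic freedom and dimensional transmutation", eq. (13.19)
"g₀^{−2} = γ₀ log(a^{−2}Λ₀^{−2}) + (γ₁/γ₀) log(log(a^{−2}Λ₀^{−2})) + O(g₀²)" and p. [66] "This equation indicates the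
well-known logarithmic decrease of the coupling with scale" — with the dictionary `a = ε = L^{−K}`,
`γ₀ log(a^{−2}) = (2γ₀ log L)·K`, so `β⁰_∞ ↔ 2γ₀ log L`; the `log log` term is of two-loop origin and is NOT derived here
(only its SIZE is matched, §5).

WHAT IS KERNEL-CHECKED ([folklore] unless marked; `K` = number of renormalization steps, `ε = L^{−K}`; a RUN `gs : ℕ → ℝ`
with `gs 0` the bare and `gs K` the renormalized coupling, `RGEqH K β gs` = (0.20); a FAMILY `g : ℕ → ℕ → ℝ`, `g K` the run
at cutoff `K`, pinned `g K K = g_IR`; `S : B12Beta.OneLoopSplit β` the printed split, `S.β0 k = β⁰_{k+1}`, `S.β1 k p =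
β¹_{k+1}(p)`).
* §1 ELEMENTARY SUMS: `inv_sqrt_succ_le` (`1/√(j+1) ≤ 2(√(j+1) − √j)`), `sum_inv_sqrt_succ_le` (`Σ_{j<n} 1/√(j+1) ≤ 2√n`),
  `sum_inv_sqrt_mul_succ_le` (`Σ_{j<n} 1/√(b(j+1)) ≤ 2√n/√b`), `le_one_div_sqrt_of_sq_le`, `tendsto_sqrt_div_self`
  (`√K/K → 0`), and the two LIMIT LEMMAS `tendsto_div_of_abs_sub_sum_le` (an envelope `|a_K − c − Σ_{k<K} u_k| ≤ E_K` with
  `E_K/K → 0` and `u_k → u_∞` gives `a_K/K → u_∞`, by Cesàro — Mathlib `Filter.Tendsto.cesaro`) and `tendsto_inv_div`.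
* §2 ONE RUN: `invSq_eq_split_sum` / `invSq_bare_eq_split_sum` (telescoped (0.20) with the split:
  `1/(gs 0)² = 1/(gs K)² + Σ_{k<K} β⁰_k + Σ_{k<K} β¹_k(g_0,…,g_k)`, from `FlowStep.inv_sq_telescopeH` BY NAME);
  `abs_sum_beta1_le` ((AF-1) ⇒ `|Σ β¹| ≤ C₁ Σ_{k<K} gs k`); the ASYMPTOTIC-FREEDOM PROFILE `run_sq_le_inv` /
  `run_le_inv_sqrt` (`(gs k)² ≤ 1/(b(K−k))`, `gs k ≤ 1/√(b(K−k))` for `k₀ ≤ k < K`, from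
  `T4CouplingMatching.inv_sq_lower_of_eventualLower` BY NAME); `sum_run_le` (`Σ_{k<K} gs k ≤ k₀γ + 2√K/√b`); and the
  ONE-LOOP LAW OF THE BARE COUPLING `abs_invSq_bare_sub_oneLoop_le`:
  `|1/(gs 0)² − 1/(gs K)² − Σ_{k<K} β⁰_k| ≤ C₁(k₀γ + 2√K/√b)`; with (AF-0r) (`abs_sum_beta0_sub_linear_le`:
  `|Σ_{k<K} β⁰_k − Kβ⁰_∞| ≤ c₀/(1−θ₀)`) the LINEAR LAW `abs_invSq_bare_sub_linear_le`:
  `|1/(gs 0)² − 1/(gs K)² − K·β⁰_∞| ≤ c₀/(1−θ₀) + C₁(k₀γ + 2√K/√b)` — uniformly in the renormalized value.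
* §3 FAMILIES OF RUNS / THE CHART / THE SCHEME: `af_le_binf` (`b ≤ β⁰_∞`: the limit coefficient inherits asymptotic freedom
  from `EventualLowerH` + (AF-1) + (AF-0)); `tendsto_invSq_bare_div` (`(1/(g K 0)²)/K → β⁰_∞` under (AF-0) as mere
  convergence) and `tendsto_mul_bare_sq` (`K·(g K 0)² → 1/β⁰_∞`); for gen 8's chart `T4BareCouplingChart.bareOf` under
  `BackwardWP β γ q`: `abs_invSq_bareOf_sub_linear_le`, `tendsto_invSq_bareOf_div`, `tendsto_mul_bareOf_sq` — the bare
  coupling «g₀(ε, g)» of Theorem 2 obeys `K·g₀(L^{−K}, g)² → 1/β⁰_∞` for EVERY `g ∈ ]0,γ]`, with the g-independent linear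
  envelope; at SCHEME level, for every `T4Continuum.FiniteEpsData` and every TUNED bare sequence `D.Tuned γ g g₀` of the
  headline's quantifier prefix (gen 7's `T4TwoRunUniqueness.rgEqH_of_tuned` + `D.flow_zero` BY NAME):
  `tuned_abs_invSq_sub_linear_le`, `tuned_tendsto_mul_sq` (`K·(g₀ K)² → 1/β⁰_∞`).
* §4 THE CONTINUUM RUNNING COUPLING (gen 5's `T4ContinuumCoupling.astar` / `gstar` / `bstar`, composing `astar_succ`,
  `astar_zero`, `abs_bstar_sub_binf_le`, `gstar_le_inv_sprof`, `one_div_gstar_sq` BY NAME): `astar_eq_sum`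
  (`a⋆_m = a⋆_0 + Σ_{l<m} b⋆_l`), `abs_astar_sub_linear_le` (`|a⋆_m − 1/g_IR² − m·β⁰_∞| ≤ 2C₁√m/√b`, (AF-0) as mere
  convergence), `tendsto_astar_div` (`a⋆_m/m → β⁰_∞`), `tendsto_mul_gstar_sq` (`m·(g⋆_m)² → 1/β⁰_∞`) — INDEPENDENT of the
  infrared datum `g_IR ∈ ]0,γ]`: at one loop the pin enters only through the next order (dimensional transmutation, as far
  as typed).
* §5 THE SHARPER REMAINDER: under a QUADRATIC remainder bound `|β¹_{k+1}(p)| ≤ C₂·p_k²` (a binder of two-loop SIZE; NOT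
  PRINTED — [Balaban1989LargeFieldII] p. 355 only names "second order perturbative calculations") the error is
  logarithmic: `sum_run_sq_le` (`Σ_{k<K} (gs k)² ≤ k₀γ² + (1 + log K)/b`, harmonic comparison
  `T4CauchySum.sum_range_div_succ_le` BY NAME) and `abs_invSq_bare_sub_oneLoop_le_log`
  (`|1/(gs 0)² − 1/(gs K)² − Σ_{k<K} β⁰_k| ≤ C₂(k₀γ² + (1 + log K)/b)`) — the size of the printed-elsewhere `(γ₁/γ₀) log log
  a^{−2}` term.  This records POSITIVELY what `T4BetaMemory.not_injectedRate_harmonicDisc` records as a hazard: size control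
  of β¹ of (AF-1) type is exactly strong enough for the one-loop asymptotics and exactly too weak for a θ-RATE of the
  two-run mismatch (node U2's wall is a Lipschitz MODULUS, not a size).
* §6 SANITY: on the constant family `β ≡ b` (gen 8's `backwardWP_const`; split `β⁰ ≡ b`, `β¹ ≡ 0`, all constants `0`) the
  linear law is the IDENTITY `1/g₀(K)² = 1/g² + K·b` (an `example`).

DECLARATIONS (30 theorems + 2 examples; no `def`, no `structure`, no `sorry`, no `axiom`).  (§1) `inv_sqrt_succ_le`,
`sum_inv_sqrt_succ_le`, `sum_inv_sqrt_mul_succ_le`, `le_one_div_sqrt_of_sq_le`, `tendsto_sqrt_div_self`,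
`tendsto_div_of_abs_sub_sum_le`, `tendsto_inv_div`.  (§2) `invSq_eq_split_sum`, `invSq_bare_eq_split_sum`,
`abs_sum_beta1_le`, `run_sq_le_inv`, `run_le_inv_sqrt`, `sum_run_le`, `abs_invSq_bare_sub_oneLoop_le`,
`abs_sum_beta0_sub_linear_le`, `abs_invSq_bare_sub_linear_le`.  (§3) `af_le_binf`, `tendsto_invSq_bare_div`,
`tendsto_mul_bare_sq`, `abs_invSq_bareOf_sub_linear_le`, `tendsto_invSq_bareOf_div`, `tendsto_mul_bareOf_sq`,
`tuned_abs_invSq_sub_linear_le`, `tuned_tendsto_mul_sq`.  (§4) `astar_eq_sum`, `abs_astar_sub_linear_le`,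
`tendsto_astar_div`, `tendsto_mul_gstar_sq`.  (§5) `sum_run_sq_le`, `abs_invSq_bare_sub_oneLoop_le_log`.  (§6) two
`example`s.

NEW module of unit `b2b-balaban-t4-ne4-p2` generation 9; imports `T4BareCouplingChart` (this lineage, gen 8, v1) only and
modifies nothing; every object of another lineage (`B12Beta.OneLoopSplit`, `FlowStep.*`, `T4CouplingMatching.*`,
`T4Continuum.FiniteEpsData.*`, `T4CauchySum.*`) is used BY NAME.
-/

namespace Literature.MathematicalPhysics.QuantumFieldTheory.Balaban1983to89.T4OneLoopAsymptotics

open Literature.MathematicalPhysics.QuantumFieldTheory.Balaban1983to89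
open Literature.MathematicalPhysics.QuantumFieldTheory.Balaban1983to89.FlowStep
open Literature.MathematicalPhysics.QuantumFieldTheory.Balaban1983to89.T4CouplingMatching
open Literature.MathematicalPhysics.QuantumFieldTheory.Balaban1983to89.T4CauchySum (InjectedRate sum_range_div_succ_le)
open Literature.MathematicalPhysics.QuantumFieldTheory.Balaban1983to89.T4ContinuumCoupling
open Literature.MathematicalPhysics.QuantumFieldTheory.Balaban1983to89.T4BareCouplingChart
open Filter Topology Finset

noncomputable section

/-! ## §1 Elementary sums and two limit lemmas -/

/-- `1/√(j+1) ≤ 2(√(j+1) − √j)` (the discrete form of `∫ t^{−1/2} dt = 2√t`). [folklore] -/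
theorem inv_sqrt_succ_le (j : ℕ) :
    1 / Real.sqrt ((j : ℝ) + 1) ≤ 2 * (Real.sqrt ((j : ℝ) + 1) - Real.sqrt (j : ℝ)) := by
  set s := Real.sqrt ((j : ℝ) + 1) with hs
  set t := Real.sqrt (j : ℝ) with ht
  have hj : (0 : ℝ) ≤ j := Nat.cast_nonneg j
  have hs2 : s ^ 2 = (j : ℝ) + 1 := Real.sq_sqrt (by positivity)
  have ht2 : t ^ 2 = (j : ℝ) := Real.sq_sqrt hj
  have hspos : 0 < s := Real.sqrt_pos.2 (by positivity)
  have hts : t ≤ s := Real.sqrt_le_sqrt (by linarith)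
  rw [div_le_iff₀ hspos]
  nlinarith [sq_nonneg (s - t)]

/-- `Σ_{j<n} 1/√(j+1) ≤ 2√n` (telescoping `inv_sqrt_succ_le`). [folklore] -/
theorem sum_inv_sqrt_succ_le (n : ℕ) :
    ∑ j ∈ range n, 1 / Real.sqrt ((j : ℝ) + 1) ≤ 2 * Real.sqrt (n : ℝ) := by
  calc ∑ j ∈ range n, 1 / Real.sqrt ((j : ℝ) + 1)
      ≤ ∑ j ∈ range n, 2 * (Real.sqrt ((j : ℝ) + 1) - Real.sqrt (j : ℝ)) :=
        sum_le_sum fun j _ => inv_sqrt_succ_le j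
    _ = 2 * Real.sqrt (n : ℝ) := by
        rw [← mul_sum]
        have h := sum_range_sub (fun j => Real.sqrt (j : ℝ)) n
        simp only [Nat.cast_succ, Nat.cast_zero, Real.sqrt_zero, sub_zero] at h
        rw [h]

/-- The profile form: for `b > 0`, `Σ_{j<n} 1/√(b(j+1)) ≤ 2√n/√b`. [folklore] -/
theorem sum_inv_sqrt_mul_succ_le {b : ℝ} (hb : 0 < b) (n : ℕ) :
    ∑ j ∈ range n, 1 / Real.sqrt (b * ((j : ℝ) + 1)) ≤ 2 * Real.sqrt (n : ℝ) / Real.sqrt b := by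
  have hsb : 0 < Real.sqrt b := Real.sqrt_pos.2 hb
  have e : ∀ j : ℕ, 1 / Real.sqrt (b * ((j : ℝ) + 1)) = 1 / Real.sqrt b * (1 / Real.sqrt ((j : ℝ) + 1)) := by
    intro j
    rw [Real.sqrt_mul hb.le, one_div_mul_one_div]
  simp_rw [e]
  rw [← mul_sum]
  calc 1 / Real.sqrt b * ∑ j ∈ range n, 1 / Real.sqrt ((j : ℝ) + 1)
      ≤ 1 / Real.sqrt b * (2 * Real.sqrt (n : ℝ)) :=
        mul_le_mul_of_nonneg_left (sum_inv_sqrt_succ_le n) (by positivity)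
    _ = 2 * Real.sqrt (n : ℝ) / Real.sqrt b := by ring

/-- From `x² ≤ 1/y` (`y > 0`) to `x ≤ 1/√y`. [folklore] -/
theorem le_one_div_sqrt_of_sq_le {x y : ℝ} (hy : 0 < y) (h : x ^ 2 ≤ 1 / y) :
    x ≤ 1 / Real.sqrt y := by
  have hsy : 0 < Real.sqrt y := Real.sqrt_pos.2 hy
  rw [le_div_iff₀ hsy]
  have h2 : (x * Real.sqrt y) ^ 2 ≤ 1 := by
    rw [mul_pow, Real.sq_sqrt hy.le]
    calc x ^ 2 * y ≤ 1 / y * y := mul_le_mul_of_nonneg_right h hy.le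
      _ = 1 := by field_simp
  nlinarith [h2]

/-- `√K/K → 0`. [folklore] -/
theorem tendsto_sqrt_div_self : Tendsto (fun K : ℕ => Real.sqrt (K : ℝ) / (K : ℝ)) atTop (𝓝 0) := by
  have h : Tendsto (fun K : ℕ => Real.sqrt (1 / (K : ℝ))) atTop (𝓝 0) := by
    simpa using (tendsto_const_div_atTop_nhds_zero_nat (1 : ℝ)).sqrt
  refine (tendsto_congr fun K => ?_).1 h
  rw [Real.sqrt_div_self', Real.sqrt_div zero_le_one, Real.sqrt_one]

/-- LIMIT LEMMA (Cesàro): an envelope `|a_K − c − Σ_{k<K} u_k| ≤ E_K` with `E_K/K → 0` and `u_k → u_∞` gives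
`a_K/K → u_∞` (Mathlib `Filter.Tendsto.cesaro`). [folklore] -/
theorem tendsto_div_of_abs_sub_sum_le {a E u : ℕ → ℝ} {c uinf : ℝ}
    (h : ∀ K, |a K - c - ∑ k ∈ range K, u k| ≤ E K) (hE : Tendsto (fun K => E K / (K : ℝ)) atTop (𝓝 0))
    (hu : Tendsto u atTop (𝓝 uinf)) : Tendsto (fun K => a K / (K : ℝ)) atTop (𝓝 uinf) := by
  have h1 : Tendsto (fun K : ℕ => (a K - c - ∑ k ∈ range K, u k) / (K : ℝ)) atTop (𝓝 0) := by
    refine squeeze_zero_norm (fun K => ?_) hE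
    rw [Real.norm_eq_abs, abs_div, Nat.abs_cast]
    exact div_le_div_of_nonneg_right (h K) (Nat.cast_nonneg K)
  have h2 : Tendsto (fun K : ℕ => c / (K : ℝ)) atTop (𝓝 0) := tendsto_const_div_atTop_nhds_zero_nat c
  have h3 : Tendsto (fun K : ℕ => (K : ℝ)⁻¹ * ∑ k ∈ range K, u k) atTop (𝓝 uinf) := hu.cesaro
  have h4 := (h1.add h2).add h3
  rw [zero_add, zero_add] at h4
  refine h4.congr' ?_
  filter_upwards [eventually_ge_atTop 1] with K hK
  have hK' : (K : ℝ) ≠ 0 := by exact_mod_cast (by omega : K ≠ 0)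
  field_simp
  ring

/-- LIMIT LEMMA: `a_K/K → u_∞ ≠ 0` gives `K/a_K → 1/u_∞`. [folklore] -/
theorem tendsto_inv_div {a : ℕ → ℝ} {uinf : ℝ} (huinf : uinf ≠ 0)
    (h : Tendsto (fun K => a K / (K : ℝ)) atTop (𝓝 uinf)) :
    Tendsto (fun K : ℕ => (K : ℝ) / a K) atTop (𝓝 (1 / uinf)) := by
  rw [one_div]
  exact (tendsto_congr fun K => inv_div (a K) (K : ℝ)).1 (h.inv₀ huinf)

/-! ## §2 One run: the one-loop split summed along a box solution of (0.20) -/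

section OneRun

variable {β : HBeta}

/-- TELESCOPED (0.20) WITH THE PRINTED SPLIT: for `i ≤ K`,
`1/(gs i)² = 1/(gs K)² + Σ_{k∈[i,K)} β⁰_k + Σ_{k∈[i,K)} β¹_k(g_0,…,g_k)` (`FlowStep.inv_sq_telescopeH` + `S.split`).
[cite: Balaban1987RG1, (0.20) p.256 and (2.12)–(2.14) p.268] -/
theorem invSq_eq_split_sum (S : B12Beta.OneLoopSplit β) {K : ℕ} {gs : ℕ → ℝ} (h : RGEqH K β gs) {i : ℕ}
    (hi : i ≤ K) :
    1 / (gs i) ^ 2 = 1 / (gs K) ^ 2 + ∑ k ∈ Ico i K, S.β0 k + ∑ k ∈ Ico i K, S.β1 k (prefixOf gs k) := by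
  rw [inv_sq_telescopeH h hi le_rfl, add_assoc, ← sum_add_distrib]
  congr 1
  exact sum_congr rfl fun k _ => S.split k _

/-- The same between the BARE and the RENORMALIZED end:
`1/(gs 0)² = 1/(gs K)² + Σ_{k<K} β⁰_k + Σ_{k<K} β¹_k(g_0,…,g_k)`.
[cite: Balaban1987RG1, (0.20) p.256 and (2.12)–(2.14) p.268] -/
theorem invSq_bare_eq_split_sum (S : B12Beta.OneLoopSplit β) {K : ℕ} {gs : ℕ → ℝ} (h : RGEqH K β gs) :
    1 / (gs 0) ^ 2 = 1 / (gs K) ^ 2 + ∑ k ∈ range K, S.β0 k + ∑ k ∈ range K, S.β1 k (prefixOf gs k) := by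
  rw [range_eq_Ico]
  exact invSq_eq_split_sum S h (Nat.zero_le K)

/-- (AF-1) SUMMED: under `|β¹_{k+1}(p)| ≤ C₁·p_k` on the boxes (a BINDER, the conclusion shape of
`B12Beta.af1_of_vanish_lipschitz`; NOT PRINTED, GAPS G-b12-2), along a box run
`|Σ_{k∈[i,K)} β¹_k| ≤ C₁ Σ_{k∈[i,K)} gs k`. [folklore] -/
theorem abs_sum_beta1_le (S : B12Beta.OneLoopSplit β) {γ C₁ : ℝ} {K : ℕ} {gs : ℕ → ℝ}
    (hbox : ∀ k, k ≤ K → 0 < gs k ∧ gs k ≤ γ)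
    (hAF1 : ∀ k (p : Fin (k + 1) → ℝ), p ∈ Box γ k → |S.β1 k p| ≤ C₁ * p (Fin.last k))
    (i : ℕ) :
    |∑ k ∈ Ico i K, S.β1 k (prefixOf gs k)| ≤ C₁ * ∑ k ∈ Ico i K, gs k := by
  rw [mul_sum]
  refine (abs_sum_le_sum_abs _ _).trans (sum_le_sum fun k hk => ?_)
  have hkK : k ≤ K := (mem_Ico.1 hk).2.le
  simpa using hAF1 k _ (prefixOf_mem_box hkK hbox)

/-- THE ASYMPTOTIC-FREEDOM PROFILE ALONG A BOX RUN, squared form: under `EventualLowerH b γ k₀ β` (`b > 0`; NOT PRINTED),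
for `k₀ ≤ k < K`, `(gs k)² ≤ 1/(b(K−k))` (`T4CouplingMatching.inv_sq_lower_of_eventualLower` BY NAME: `1/(gs k)² ≥ 1/(gs K)² +
b(K−k)`). [cite: Balaban1987RG1, (0.31) p.259] -/
theorem run_sq_le_inv {γ b : ℝ} {k₀ K : ℕ} {gs : ℕ → ℝ} (h : RGEqH K β gs)
    (hbox : ∀ k, k ≤ K → 0 < gs k ∧ gs k ≤ γ) (hb : 0 < b) (hlo : EventualLowerH b γ k₀ β)
    {k : ℕ} (hk₀ : k₀ ≤ k) (hk : k < K) :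
    (gs k) ^ 2 ≤ 1 / (b * ((K - k : ℕ) : ℝ)) := by
  have hlow := inv_sq_lower_of_eventualLower h hbox hlo hk₀ hk.le
  have hposK : 0 < 1 / (gs K) ^ 2 := by have := (hbox K le_rfl).1; positivity
  have hn : (0 : ℝ) < ((K - k : ℕ) : ℝ) := by exact_mod_cast Nat.sub_pos_of_lt hk
  have hbn : 0 < b * ((K - k : ℕ) : ℝ) := mul_pos hb hn
  have hgk := (hbox k hk.le).1
  rw [le_one_div (pow_pos hgk 2) hbn]
  linarith

/-- … and the coupling form `gs k ≤ 1/√(b(K−k))` for `k₀ ≤ k < K`. [cite: Balaban1987RG1, (0.31) p.259] -/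
theorem run_le_inv_sqrt {γ b : ℝ} {k₀ K : ℕ} {gs : ℕ → ℝ} (h : RGEqH K β gs)
    (hbox : ∀ k, k ≤ K → 0 < gs k ∧ gs k ≤ γ) (hb : 0 < b) (hlo : EventualLowerH b γ k₀ β)
    {k : ℕ} (hk₀ : k₀ ≤ k) (hk : k < K) :
    gs k ≤ 1 / Real.sqrt (b * ((K - k : ℕ) : ℝ)) := by
  have hn : (0 : ℝ) < ((K - k : ℕ) : ℝ) := by exact_mod_cast Nat.sub_pos_of_lt hk
  exact le_one_div_sqrt_of_sq_le (mul_pos hb hn) (run_sq_le_inv h hbox hb hlo hk₀ hk)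

/-- THE SUM OF THE COUPLINGS ALONG A BOX RUN IS `O(√K)`: `Σ_{k<K} gs k ≤ k₀γ + 2√K/√b` (the first `k₀` scales cost `γ`
each; from scale `k₀` on the profile `gs k ≤ (b(K−k))^{−1/2}` and `Σ_{j≤n} j^{−1/2} ≤ 2√n`). [folklore] -/
theorem sum_run_le {γ b : ℝ} {k₀ K : ℕ} {gs : ℕ → ℝ} (h : RGEqH K β gs)
    (hbox : ∀ k, k ≤ K → 0 < gs k ∧ gs k ≤ γ) (hb : 0 < b) (hlo : EventualLowerH b γ k₀ β) :
    ∑ k ∈ range K, gs k ≤ (k₀ : ℝ) * γ + 2 * Real.sqrt (K : ℝ) / Real.sqrt b := by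
  have hγ : 0 ≤ γ := (hbox K le_rfl).1.le.trans (hbox K le_rfl).2
  have hsb : 0 < Real.sqrt b := Real.sqrt_pos.2 hb
  rw [← sum_range_reflect, ← sum_range_add_sum_Ico _ (Nat.sub_le K k₀)]
  have h1 : ∑ j ∈ range (K - k₀), gs (K - 1 - j) ≤ 2 * Real.sqrt (K : ℝ) / Real.sqrt b := by
    calc ∑ j ∈ range (K - k₀), gs (K - 1 - j)
        ≤ ∑ j ∈ range (K - k₀), 1 / Real.sqrt (b * ((j : ℝ) + 1)) := sum_le_sum fun j hj => by
          have hj := mem_range.1 hj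
          have hk₀ : k₀ ≤ K - 1 - j := by omega
          have hk : K - 1 - j < K := by omega
          have e : ((K - (K - 1 - j) : ℕ) : ℝ) = (j : ℝ) + 1 := by
            have : K - (K - 1 - j) = j + 1 := by omega
            rw [this]; push_cast; ring
          have := run_le_inv_sqrt h hbox hb hlo hk₀ hk
          rwa [e] at this
      _ ≤ 2 * Real.sqrt ((K - k₀ : ℕ) : ℝ) / Real.sqrt b := sum_inv_sqrt_mul_succ_le hb _
      _ ≤ 2 * Real.sqrt (K : ℝ) / Real.sqrt b :=
          div_le_div_of_nonneg_right
            (mul_le_mul_of_nonneg_left (Real.sqrt_le_sqrt (by exact_mod_cast Nat.sub_le K k₀)) two_pos.le)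
            hsb.le
  have h2 : ∑ j ∈ Ico (K - k₀) K, gs (K - 1 - j) ≤ (k₀ : ℝ) * γ := by
    calc ∑ j ∈ Ico (K - k₀) K, gs (K - 1 - j) ≤ ∑ j ∈ Ico (K - k₀) K, γ :=
          sum_le_sum fun j hj => (hbox _ (by omega)).2
      _ = ((K - (K - k₀) : ℕ) : ℝ) * γ := by rw [sum_const, Nat.card_Ico, nsmul_eq_mul]
      _ ≤ (k₀ : ℝ) * γ :=
          mul_le_mul_of_nonneg_right (by exact_mod_cast (by omega : K - (K - k₀) ≤ k₀)) hγ
  linarith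

/-- **THE ONE-LOOP LAW OF THE BARE COUPLING (run level).**  Along any solution of (0.20) in the box ]0,γ] with `K` steps,
under (AF-1) `|β¹_{k+1}(p)| ≤ C₁·p_k` (`C₁ ≥ 0`) and `EventualLowerH b γ k₀ β` (`b > 0`) — both BINDERS, NOT PRINTED:
`|1/(gs 0)² − 1/(gs K)² − Σ_{k<K} β⁰_k| ≤ C₁·(k₀γ + 2√K/√b)`.  The bare inverse coupling is the sum of the COUPLING-FREE
one-loop coefficients up to `O(√K)`, uniformly in the renormalized value `gs K ∈ ]0,γ]`.
[cite: Balaban1987RG1, (0.20) p.256 and Thm 2 p.259] -/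
theorem abs_invSq_bare_sub_oneLoop_le (S : B12Beta.OneLoopSplit β) {γ b C₁ : ℝ} {k₀ K : ℕ} {gs : ℕ → ℝ}
    (h : RGEqH K β gs) (hbox : ∀ k, k ≤ K → 0 < gs k ∧ gs k ≤ γ) (hb : 0 < b)
    (hlo : EventualLowerH b γ k₀ β) (hC₁ : 0 ≤ C₁)
    (hAF1 : ∀ k (p : Fin (k + 1) → ℝ), p ∈ Box γ k → |S.β1 k p| ≤ C₁ * p (Fin.last k)) :
    |1 / (gs 0) ^ 2 - 1 / (gs K) ^ 2 - ∑ k ∈ range K, S.β0 k| ≤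
      C₁ * ((k₀ : ℝ) * γ + 2 * Real.sqrt (K : ℝ) / Real.sqrt b) := by
  have e : 1 / (gs 0) ^ 2 - 1 / (gs K) ^ 2 - ∑ k ∈ range K, S.β0 k = ∑ k ∈ range K, S.β1 k (prefixOf gs k) := by
    rw [invSq_bare_eq_split_sum S h]; ring
  rw [e]
  have h1 := abs_sum_beta1_le S hbox hAF1 0
  rw [← range_eq_Ico] at h1
  exact h1.trans (mul_le_mul_of_nonneg_left (sum_run_le h hbox hb hlo) hC₁)

/-- (AF-0r) SUMMED: the rate form `|β⁰_k − β⁰_∞| ≤ c₀θ₀^k` (`0 ≤ θ₀ < 1`; the β sub-cell's (AF-0r), a BINDER — the `hconv`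
shape of `FlowStepRuns` §10; NOT PRINTED) gives `|Σ_{k<K} β⁰_k − K·β⁰_∞| ≤ c₀/(1−θ₀)` (Mathlib
`geom_sum_Ico_le_of_lt_one`). [folklore] -/
theorem abs_sum_beta0_sub_linear_le (S : B12Beta.OneLoopSplit β) {binf c₀ θ₀ : ℝ} (hθ0 : 0 ≤ θ₀) (hθ1 : θ₀ < 1)
    (hconv : ∀ k, |S.β0 k - binf| ≤ c₀ * θ₀ ^ k) (K : ℕ) :
    |∑ k ∈ range K, S.β0 k - (K : ℝ) * binf| ≤ c₀ / (1 - θ₀) := by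
  have hc₀ : 0 ≤ c₀ := by have := (abs_nonneg _).trans (hconv 0); simpa using this
  have e : ∑ k ∈ range K, S.β0 k - (K : ℝ) * binf = ∑ k ∈ range K, (S.β0 k - binf) := by
    rw [sum_sub_distrib, sum_const, card_range, nsmul_eq_mul]
  rw [e]
  refine (abs_sum_le_sum_abs _ _).trans ((sum_le_sum fun k _ => hconv k).trans ?_)
  rw [← mul_sum]
  have hg : ∑ k ∈ range K, θ₀ ^ k ≤ 1 / (1 - θ₀) := by
    have := geom_sum_Ico_le_of_lt_one hθ0 hθ1 (m := 0) (n := K)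
    rw [range_eq_Ico]
    simpa using this
  calc c₀ * ∑ k ∈ range K, θ₀ ^ k ≤ c₀ * (1 / (1 - θ₀)) := mul_le_mul_of_nonneg_left hg hc₀
    _ = c₀ / (1 - θ₀) := by ring

/-- **THE LINEAR LAW OF THE BARE COUPLING (run level).**  Under (AF-0r), (AF-1) and `EventualLowerH b` as BINDERS:
`|1/(gs 0)² − 1/(gs K)² − K·β⁰_∞| ≤ c₀/(1−θ₀) + C₁(k₀γ + 2√K/√b)` — the inverse bare coupling grows LINEARLY in the number
of steps `K = log_L(1/ε)` with the UNIVERSAL slope `β⁰_∞` (the limit of the coupling-free one-loop coefficients), the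
renormalized value entering only the `O(√K)`-bounded remainder. [cite: Balaban1987RG1, (0.18) p.255 and Thm 2 p.259] -/
theorem abs_invSq_bare_sub_linear_le (S : B12Beta.OneLoopSplit β) {γ b C₁ binf c₀ θ₀ : ℝ} {k₀ K : ℕ} {gs : ℕ → ℝ}
    (h : RGEqH K β gs) (hbox : ∀ k, k ≤ K → 0 < gs k ∧ gs k ≤ γ) (hb : 0 < b)
    (hlo : EventualLowerH b γ k₀ β) (hC₁ : 0 ≤ C₁)
    (hAF1 : ∀ k (p : Fin (k + 1) → ℝ), p ∈ Box γ k → |S.β1 k p| ≤ C₁ * p (Fin.last k))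
    (hθ0 : 0 ≤ θ₀) (hθ1 : θ₀ < 1) (hconv : ∀ k, |S.β0 k - binf| ≤ c₀ * θ₀ ^ k) :
    |1 / (gs 0) ^ 2 - 1 / (gs K) ^ 2 - (K : ℝ) * binf| ≤
      c₀ / (1 - θ₀) + C₁ * ((k₀ : ℝ) * γ + 2 * Real.sqrt (K : ℝ) / Real.sqrt b) := by
  have h1 := abs_invSq_bare_sub_oneLoop_le S h hbox hb hlo hC₁ hAF1
  have h2 := abs_sum_beta0_sub_linear_le S hθ0 hθ1 hconv K
  have e : 1 / (gs 0) ^ 2 - 1 / (gs K) ^ 2 - (K : ℝ) * binf =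
      (1 / (gs 0) ^ 2 - 1 / (gs K) ^ 2 - ∑ k ∈ range K, S.β0 k) + (∑ k ∈ range K, S.β0 k - (K : ℝ) * binf) := by
    ring
  rw [e]
  linarith [abs_add_le (1 / (gs 0) ^ 2 - 1 / (gs K) ^ 2 - ∑ k ∈ range K, S.β0 k)
    (∑ k ∈ range K, S.β0 k - (K : ℝ) * binf)]

end OneRun

/-! ## §3 Families of runs (ε = L^{−K} → 0): the bare coupling, the chart «g₀(ε, g)», the tuned sequences of the scheme -/

section Families

variable {β : HBeta}

/-- THE LIMIT COEFFICIENT INHERITS ASYMPTOTIC FREEDOM: `EventualLowerH b γ k₀ β`, (AF-1) and (AF-0) `β⁰_k → β⁰_∞` (all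
BINDERS) give `b ≤ β⁰_∞` (evaluate the split on the constant histories `t ∈ ]0,γ]`, let `k → ∞`, then `t → 0⁺`).
[folklore] -/
theorem af_le_binf (S : B12Beta.OneLoopSplit β) {γ b C₁ binf : ℝ} {k₀ : ℕ} (hγ : 0 < γ)
    (hlo : EventualLowerH b γ k₀ β)
    (hAF1 : ∀ k (p : Fin (k + 1) → ℝ), p ∈ Box γ k → |S.β1 k p| ≤ C₁ * p (Fin.last k))
    (hconv : Tendsto S.β0 atTop (𝓝 binf)) : b ≤ binf := by
  have key : ∀ t, 0 < t → t ≤ γ → b - C₁ * t ≤ binf := by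
    intro t ht htγ
    refine ge_of_tendsto hconv (eventually_atTop.2 ⟨k₀, fun k hk => ?_⟩)
    have hp : (fun _ : Fin (k + 1) => t) ∈ Box γ k := mem_box.2 fun _ => ⟨ht, htγ⟩
    have h1 := hlo k _ hk hp
    have h2 := (abs_le.1 (hAF1 k _ hp)).2
    rw [S.split k] at h1
    linarith
  by_contra hlt
  rw [not_le] at hlt
  rcases le_or_gt C₁ 0 with hC | hC
  · have h1 := key γ hγ le_rfl
    nlinarith
  · set t := min γ ((b - binf) / (2 * C₁)) with ht
    have htpos : 0 < t := lt_min hγ (div_pos (by linarith) (by linarith))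
    have h1 := key t htpos (min_le_left _ _)
    have h2 : C₁ * t ≤ (b - binf) / 2 :=
      calc C₁ * t ≤ C₁ * ((b - binf) / (2 * C₁)) := mul_le_mul_of_nonneg_left (min_le_right _ _) hC.le
        _ = (b - binf) / 2 := by field_simp
    linarith

variable {g : ℕ → ℕ → ℝ} {γ gIR b C₁ binf : ℝ} {k₀ : ℕ}

/-- **ASYMPTOTIC FREEDOM OF THE BARE COUPLING AT THE UNIVERSAL ONE-LOOP RATE (inverse form).**  For a family of box
solutions of (0.20), `g K` with `K` steps and the common renormalized value `g K K = g_IR`, under `EventualLowerH b` (`b >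
0`), (AF-1) and (AF-0) `β⁰_k → β⁰_∞` as MERE CONVERGENCE (all BINDERS): `(1/(g K 0)²)/K → β⁰_∞` as `K → ∞` — Cesàro on the
one-loop law `abs_invSq_bare_sub_oneLoop_le`. [cite: Balaban1987RG1, (0.18) p.255 and Thm 2 p.259] -/
theorem tendsto_invSq_bare_div (S : B12Beta.OneLoopSplit β) (hrun : ∀ K, RGEqH K β (g K))
    (hbox : ∀ K i, i ≤ K → 0 < g K i ∧ g K i ≤ γ) (hpin : ∀ K, g K K = gIR) (hb : 0 < b)
    (hlo : EventualLowerH b γ k₀ β) (hC₁ : 0 ≤ C₁)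
    (hAF1 : ∀ k (p : Fin (k + 1) → ℝ), p ∈ Box γ k → |S.β1 k p| ≤ C₁ * p (Fin.last k))
    (hconv : Tendsto S.β0 atTop (𝓝 binf)) :
    Tendsto (fun K => (1 / (g K 0) ^ 2) / (K : ℝ)) atTop (𝓝 binf) := by
  refine tendsto_div_of_abs_sub_sum_le (c := 1 / gIR ^ 2)
    (E := fun K => C₁ * ((k₀ : ℝ) * γ + 2 * Real.sqrt (K : ℝ) / Real.sqrt b)) (fun K => ?_) ?_ hconv
  · have h := abs_invSq_bare_sub_oneLoop_le S (hrun K) (hbox K) hb hlo hC₁ hAF1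
    rwa [hpin K] at h
  · have h1 : Tendsto (fun K : ℕ => C₁ * (k₀ : ℝ) * γ / (K : ℝ)) atTop (𝓝 0) :=
      tendsto_const_div_atTop_nhds_zero_nat _
    have h2 : Tendsto (fun K : ℕ => 2 * C₁ / Real.sqrt b * (Real.sqrt (K : ℝ) / (K : ℝ))) atTop (𝓝 0) := by
      simpa using tendsto_sqrt_div_self.const_mul (2 * C₁ / Real.sqrt b)
    have h3 := h1.add h2
    rw [add_zero] at h3
    refine (tendsto_congr fun K => ?_).2 h3
    ring

/-- **… product form: `K·(g K 0)² → 1/β⁰_∞`** — the bare coupling of a `K`-step tuning is `(β⁰_∞·K)^{−1/2}(1 + o(1))`,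
`K = log_L(1/ε)`: "the well-known logarithmic decrease of the coupling with scale" at the universal one-loop rate, for
the discrete flow (0.20) under the stated BINDERS (`β⁰_∞ ≥ b > 0` by `af_le_binf`).
[cite: Balaban1987RG1, (0.18) p.255 and Thm 2 p.259] -/
theorem tendsto_mul_bare_sq (S : B12Beta.OneLoopSplit β) (hrun : ∀ K, RGEqH K β (g K))
    (hbox : ∀ K i, i ≤ K → 0 < g K i ∧ g K i ≤ γ) (hpin : ∀ K, g K K = gIR) (hb : 0 < b)
    (hlo : EventualLowerH b γ k₀ β) (hC₁ : 0 ≤ C₁)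
    (hAF1 : ∀ k (p : Fin (k + 1) → ℝ), p ∈ Box γ k → |S.β1 k p| ≤ C₁ * p (Fin.last k))
    (hconv : Tendsto S.β0 atTop (𝓝 binf)) :
    Tendsto (fun K : ℕ => (K : ℝ) * (g K 0) ^ 2) atTop (𝓝 (1 / binf)) := by
  have hγ : 0 < γ := by
    have h := hbox 0 0 le_rfl
    exact h.1.trans_le h.2
  have hbinf : binf ≠ 0 := (hb.trans_le (af_le_binf S hγ hlo hAF1 hconv)).ne'
  have h := tendsto_inv_div hbinf (tendsto_invSq_bare_div S hrun hbox hpin hb hlo hC₁ hAF1 hconv)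
  exact (tendsto_congr fun K => by rw [one_div (g K 0 ^ 2), div_inv_eq_mul]).1 h

/-- **THE CHART «g₀(ε, g)» OBEYS THE LINEAR LAW**, uniformly in `g ∈ ]0,γ]`: under gen 8's package `BackwardWP β γ q` and
the BINDERS (AF-0r), (AF-1), `EventualLowerH b`:
`|1/g₀(L^{−K}, g)² − 1/g² − K·β⁰_∞| ≤ c₀/(1−θ₀) + C₁(k₀γ + 2√K/√b)`. [cite: Balaban1987RG1, Thm 2 p.259] -/
theorem abs_invSq_bareOf_sub_linear_le {q c₀ θ₀ : ℝ} (H : BackwardWP β γ q) (S : B12Beta.OneLoopSplit β)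
    (hb : 0 < b) (hlo : EventualLowerH b γ k₀ β) (hC₁ : 0 ≤ C₁)
    (hAF1 : ∀ k (p : Fin (k + 1) → ℝ), p ∈ Box γ k → |S.β1 k p| ≤ C₁ * p (Fin.last k))
    (hθ0 : 0 ≤ θ₀) (hθ1 : θ₀ < 1) (hconv : ∀ k, |S.β0 k - binf| ≤ c₀ * θ₀ ^ k)
    (K : ℕ) {x : ℝ} (hx : 0 < x) (hxγ : x ≤ γ) :
    |1 / (bareOf β γ K x) ^ 2 - 1 / x ^ 2 - (K : ℝ) * binf| ≤
      c₀ / (1 - θ₀) + C₁ * ((k₀ : ℝ) * γ + 2 * Real.sqrt (K : ℝ) / Real.sqrt b) := by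
  obtain ⟨gs, hK, h, hbox, h0⟩ := H.bareOf_spec K hx hxγ
  rw [← h0, ← hK]
  exact abs_invSq_bare_sub_linear_le S h hbox hb hlo hC₁ hAF1 hθ0 hθ1 hconv

/-- **THE CHART IS ASYMPTOTICALLY FREE AT THE UNIVERSAL RATE (inverse form)**: for every `g ∈ ]0,γ]`,
`(1/g₀(L^{−K}, g)²)/K → β⁰_∞` — (AF-0) as mere convergence. [cite: Balaban1987RG1, Thm 2 p.259] -/
theorem tendsto_invSq_bareOf_div {q : ℝ} (H : BackwardWP β γ q) (S : B12Beta.OneLoopSplit β)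
    (hb : 0 < b) (hlo : EventualLowerH b γ k₀ β) (hC₁ : 0 ≤ C₁)
    (hAF1 : ∀ k (p : Fin (k + 1) → ℝ), p ∈ Box γ k → |S.β1 k p| ≤ C₁ * p (Fin.last k))
    (hconv : Tendsto S.β0 atTop (𝓝 binf)) {x : ℝ} (hx : 0 < x) (hxγ : x ≤ γ) :
    Tendsto (fun K => (1 / (bareOf β γ K x) ^ 2) / (K : ℝ)) atTop (𝓝 binf) := by
  refine tendsto_div_of_abs_sub_sum_le (c := 1 / x ^ 2)
    (E := fun K => C₁ * ((k₀ : ℝ) * γ + 2 * Real.sqrt (K : ℝ) / Real.sqrt b)) (fun K => ?_) ?_ hconv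
  · obtain ⟨gs, hK, h, hbox, h0⟩ := H.bareOf_spec K hx hxγ
    rw [← h0, ← hK]
    exact abs_invSq_bare_sub_oneLoop_le S h hbox hb hlo hC₁ hAF1
  · have h1 : Tendsto (fun K : ℕ => C₁ * (k₀ : ℝ) * γ / (K : ℝ)) atTop (𝓝 0) :=
      tendsto_const_div_atTop_nhds_zero_nat _
    have h2 : Tendsto (fun K : ℕ => 2 * C₁ / Real.sqrt b * (Real.sqrt (K : ℝ) / (K : ℝ))) atTop (𝓝 0) := by
      simpa using tendsto_sqrt_div_self.const_mul (2 * C₁ / Real.sqrt b)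
    have h3 := h1.add h2
    rw [add_zero] at h3
    refine (tendsto_congr fun K => ?_).2 h3
    ring

/-- **… product form: `K·g₀(L^{−K}, g)² → 1/β⁰_∞` for every `g ∈ ]0,γ]`** — the same limit for every renormalized value
(the pin enters only at the next order). [cite: Balaban1987RG1, Thm 2 p.259] -/
theorem tendsto_mul_bareOf_sq {q : ℝ} (H : BackwardWP β γ q) (S : B12Beta.OneLoopSplit β)
    (hb : 0 < b) (hlo : EventualLowerH b γ k₀ β) (hC₁ : 0 ≤ C₁)
    (hAF1 : ∀ k (p : Fin (k + 1) → ℝ), p ∈ Box γ k → |S.β1 k p| ≤ C₁ * p (Fin.last k))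
    (hconv : Tendsto S.β0 atTop (𝓝 binf)) {x : ℝ} (hx : 0 < x) (hxγ : x ≤ γ) :
    Tendsto (fun K : ℕ => (K : ℝ) * (bareOf β γ K x) ^ 2) atTop (𝓝 (1 / binf)) := by
  have hbinf : binf ≠ 0 := (hb.trans_le (af_le_binf S H.pos hlo hAF1 hconv)).ne'
  have h := tendsto_inv_div hbinf (tendsto_invSq_bareOf_div H S hb hlo hC₁ hAF1 hconv hx hxγ)
  exact (tendsto_congr fun K => by rw [one_div (bareOf β γ K x ^ 2), div_inv_eq_mul]).1 h

end Families

/-! ### Scheme level: every TUNED bare sequence of `T4Continuum.FiniteEpsData` obeys the law -/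

section SchemeLevel

open T4Continuum T4TwoRunUniqueness

universe u

variable {F : T4Family} {G : Type u} [GaugeGroup G] [MeasurableSpace G] [HaarData G]

/-- **THE TUNED BARE COUPLINGS OF THEOREM 2's PREFIX OBEY THE LINEAR LAW.**  For a `FiniteEpsData` `D`, a bare sequence `g₀`
tuned to `g` within ]0,γ] (`D.Tuned γ g g₀`, the renormalization condition of the headline's quantifier prefix), the
PRINTED upper bound `BetaUpperH β′ γᵤ D.βfun` with `γᵤ²β′ < 1` (for (0.20) along the construction's runs, gen 7's
`rgEqH_of_tuned`), and the BINDERS (AF-0r), (AF-1), `EventualLowerH b γ k₀ D.βfun`: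
`|1/(g₀ K)² − 1/g² − K·β⁰_∞| ≤ c₀/(1−θ₀) + C₁(k₀γ + 2√K/√b)` for every `K`. [cite: Balaban1987RG1, Thm 2 p.259] -/
theorem tuned_abs_invSq_sub_linear_le (D : FiniteEpsData F G) (S : B12Beta.OneLoopSplit D.βfun)
    {β' γu γ g b C₁ binf c₀ θ₀ : ℝ} {k₀ : ℕ} {g₀ : ℕ → ℝ}
    (hhi : BetaUpperH β' γu D.βfun) (hγβ : γu ^ 2 * β' < 1) (hγ : 0 < γ) (hγle : γ ≤ γu)
    (ht : D.Tuned γ g g₀) (hb : 0 < b) (hlo : EventualLowerH b γ k₀ D.βfun) (hC₁ : 0 ≤ C₁)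
    (hAF1 : ∀ k (p : Fin (k + 1) → ℝ), p ∈ Box γ k → |S.β1 k p| ≤ C₁ * p (Fin.last k))
    (hθ0 : 0 ≤ θ₀) (hθ1 : θ₀ < 1) (hconv : ∀ k, |S.β0 k - binf| ≤ c₀ * θ₀ ^ k) (K : ℕ) :
    |1 / (g₀ K) ^ 2 - 1 / g ^ 2 - (K : ℝ) * binf| ≤
      c₀ / (1 - θ₀) + C₁ * ((k₀ : ℝ) * γ + 2 * Real.sqrt (K : ℝ) / Real.sqrt b) := by
  have h := rgEqH_of_tuned D hhi hγβ hγ hγle ht K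
  have hbox : ∀ k, k ≤ K → 0 < (D.C ⟨K, F.m, g₀ K⟩).flow.g k ∧ (D.C ⟨K, F.m, g₀ K⟩).flow.g k ≤ γ := (ht K).1
  have h1 := abs_invSq_bare_sub_linear_le S h hbox hb hlo hC₁ hAF1 hθ0 hθ1 hconv
  rwa [D.flow_zero K (g₀ K), (ht K).2] at h1

/-- **EVERY TUNED BARE SEQUENCE IS ASYMPTOTICALLY FREE AT THE UNIVERSAL ONE-LOOP RATE: `K·(g₀ K)² → 1/β⁰_∞`** ((AF-0) as
mere convergence; the Wilson inverse couplings `(g₀ K)^{−2}` of the scheme grow like `β⁰_∞·K`, `K = log_L(1/ε)`).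
[cite: Balaban1987RG1, Thm 2 p.259] -/
theorem tuned_tendsto_mul_sq (D : FiniteEpsData F G) (S : B12Beta.OneLoopSplit D.βfun)
    {β' γu γ g b C₁ binf : ℝ} {k₀ : ℕ} {g₀ : ℕ → ℝ}
    (hhi : BetaUpperH β' γu D.βfun) (hγβ : γu ^ 2 * β' < 1) (hγ : 0 < γ) (hγle : γ ≤ γu)
    (ht : D.Tuned γ g g₀) (hb : 0 < b) (hlo : EventualLowerH b γ k₀ D.βfun) (hC₁ : 0 ≤ C₁)
    (hAF1 : ∀ k (p : Fin (k + 1) → ℝ), p ∈ Box γ k → |S.β1 k p| ≤ C₁ * p (Fin.last k))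
    (hconv : Tendsto S.β0 atTop (𝓝 binf)) :
    Tendsto (fun K : ℕ => (K : ℝ) * (g₀ K) ^ 2) atTop (𝓝 (1 / binf)) := by
  let gfam : ℕ → ℕ → ℝ := fun K => (D.C ⟨K, F.m, g₀ K⟩).flow.g
  have hrun : ∀ K, RGEqH K D.βfun (gfam K) := fun K => rgEqH_of_tuned D hhi hγβ hγ hγle ht K
  have hbox : ∀ K i, i ≤ K → 0 < gfam K i ∧ gfam K i ≤ γ := fun K => (ht K).1
  have hpin : ∀ K, gfam K K = g := fun K => (ht K).2
  have h := tendsto_mul_bare_sq S hrun hbox hpin hb hlo hC₁ hAF1 hconv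
  refine (tendsto_congr fun K => ?_).1 h
  show (K : ℝ) * ((D.C ⟨K, F.m, g₀ K⟩).flow.g 0) ^ 2 = (K : ℝ) * (g₀ K) ^ 2
  rw [D.flow_zero K (g₀ K)]

end SchemeLevel

/-! ## §4 The continuum running coupling deep in the ultraviolet (m → ∞) -/

section Continuum

variable {β : HBeta} {g : ℕ → ℕ → ℝ} {γ gIR C θ b C₁ binf : ℝ} {k₀ : ℕ}

/-- `a⋆_m = a⋆_0 + Σ_{l<m} b⋆_l` (gen 5's `astar_succ`, summed). [folklore] -/
theorem astar_eq_sum (m : ℕ) : astar g m = astar g 0 + ∑ l ∈ range m, bstar g l := by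
  induction m with
  | zero => simp
  | succ m ih => rw [astar_succ, ih, sum_range_succ, add_assoc]

/-- **THE LINEAR LAW OF THE CONTINUUM RUNNING COUPLING.**  Under NE4's output shape `InjectedRate C 0 θ (disc …)` (`θ <
1`), run-wise (0.20), the box, the pin `g K K = g_IR`, `EventualLowerH b γ k₀ β` (`b > 0`), (AF-1) and (AF-0) `β⁰_k → β⁰_∞`
as MERE CONVERGENCE — all BINDERS — gen 5's continuum inverse coupling `a⋆_m = 1/(g⋆_m)²` satisfies
`|a⋆_m − 1/g_IR² − m·β⁰_∞| ≤ 2C₁√m/√b`: composing `abs_bstar_sub_binf_le` (`|b⋆_l − β⁰_∞| ≤ C₁ g⋆_{l+1}`) with the profile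
`g⋆_{l+1} ≤ (1/g_IR² + b(l+1))^{−1/2}` (`gstar_le_inv_sprof`) and `Σ_{l≤m} l^{−1/2} ≤ 2√m`. [folklore] -/
theorem abs_astar_sub_linear_le (S : B12Beta.OneLoopSplit β) (hθ1 : θ < 1)
    (hinj : InjectedRate C 0 θ (fun K j => disc (g K) (g (K + 1)) j)) (hrun : ∀ K, RGEqH K β (g K))
    (hbox : ∀ K i, i ≤ K → 0 < g K i ∧ g K i ≤ γ) (hpin : ∀ K, g K K = gIR)
    (hb : 0 < b) (hlo : EventualLowerH b γ k₀ β) (hC₁ : 0 ≤ C₁)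
    (hAF1 : ∀ k (p : Fin (k + 1) → ℝ), p ∈ Box γ k → |S.β1 k p| ≤ C₁ * p (Fin.last k))
    (hconv : Tendsto S.β0 atTop (𝓝 binf)) (m : ℕ) :
    |astar g m - 1 / gIR ^ 2 - (m : ℝ) * binf| ≤ 2 * C₁ * Real.sqrt (m : ℝ) / Real.sqrt b := by
  rw [astar_eq_sum, astar_zero hθ1 hinj hpin]
  have e : 1 / gIR ^ 2 + ∑ l ∈ range m, bstar g l - 1 / gIR ^ 2 - (m : ℝ) * binf =
      ∑ l ∈ range m, (bstar g l - binf) := by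
    rw [sum_sub_distrib, sum_const, card_range, nsmul_eq_mul]; ring
  rw [e]
  calc |∑ l ∈ range m, (bstar g l - binf)| ≤ ∑ l ∈ range m, |bstar g l - binf| := abs_sum_le_sum_abs _ _
    _ ≤ ∑ l ∈ range m, C₁ * (1 / Real.sqrt (b * ((l : ℝ) + 1))) := sum_le_sum fun l _ => by
        refine (abs_bstar_sub_binf_le S hθ1 hinj hrun hbox hconv hAF1 l).trans ?_
        refine mul_le_mul_of_nonneg_left ?_ hC₁
        refine (gstar_le_inv_sprof hθ1 hinj hrun hbox hpin hlo hb.le (l + 1)).trans ?_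
        have hbl : 0 < b * ((l : ℝ) + 1) := by positivity
        refine one_div_le_one_div_of_le (Real.sqrt_pos.2 hbl) ?_
        unfold sprof prof
        push_cast
        exact Real.sqrt_le_sqrt (le_add_of_nonneg_left (by positivity))
    _ = C₁ * ∑ l ∈ range m, 1 / Real.sqrt (b * ((l : ℝ) + 1)) := by rw [mul_sum]
    _ ≤ C₁ * (2 * Real.sqrt (m : ℝ) / Real.sqrt b) := mul_le_mul_of_nonneg_left (sum_inv_sqrt_mul_succ_le hb m) hC₁
    _ = 2 * C₁ * Real.sqrt (m : ℝ) / Real.sqrt b := by ring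

/-- **THE CONTINUUM COUPLING IS ASYMPTOTICALLY FREE AT THE UNIVERSAL RATE (inverse form): `a⋆_m/m → β⁰_∞`.** [folklore] -/
theorem tendsto_astar_div (S : B12Beta.OneLoopSplit β) (hθ1 : θ < 1)
    (hinj : InjectedRate C 0 θ (fun K j => disc (g K) (g (K + 1)) j)) (hrun : ∀ K, RGEqH K β (g K))
    (hbox : ∀ K i, i ≤ K → 0 < g K i ∧ g K i ≤ γ) (hpin : ∀ K, g K K = gIR)
    (hb : 0 < b) (hlo : EventualLowerH b γ k₀ β) (hC₁ : 0 ≤ C₁)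
    (hAF1 : ∀ k (p : Fin (k + 1) → ℝ), p ∈ Box γ k → |S.β1 k p| ≤ C₁ * p (Fin.last k))
    (hconv : Tendsto S.β0 atTop (𝓝 binf)) :
    Tendsto (fun m => astar g m / (m : ℝ)) atTop (𝓝 binf) := by
  -- the envelope is stated against `m·β⁰_∞` directly; feed the Cesàro lemma with the CONSTANT sequence `β⁰_∞`.
  refine tendsto_div_of_abs_sub_sum_le (c := 1 / gIR ^ 2) (u := fun _ => binf)
    (E := fun m => 2 * C₁ * Real.sqrt (m : ℝ) / Real.sqrt b) (fun m => ?_) ?_ tendsto_const_nhds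
  · have h := abs_astar_sub_linear_le S hθ1 hinj hrun hbox hpin hb hlo hC₁ hAF1 hconv m
    rwa [sum_const, card_range, nsmul_eq_mul]
  · have h2 : Tendsto (fun m : ℕ => 2 * C₁ / Real.sqrt b * (Real.sqrt (m : ℝ) / (m : ℝ))) atTop (𝓝 0) := by
      simpa using tendsto_sqrt_div_self.const_mul (2 * C₁ / Real.sqrt b)
    refine (tendsto_congr fun m => ?_).2 h2
    ring

/-- **… product form: `m·(g⋆_m)² → 1/β⁰_∞`** — at `m` factors of `L` above the infrared scale the continuum running
coupling is `(β⁰_∞·m)^{−1/2}(1 + o(1))`, the SAME for every infrared datum `g_IR ∈ ]0,γ]` (one-loop dimensional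
transmutation, as far as typed: the pin enters only through the next order). [folklore] -/
theorem tendsto_mul_gstar_sq (S : B12Beta.OneLoopSplit β) (hθ1 : θ < 1)
    (hinj : InjectedRate C 0 θ (fun K j => disc (g K) (g (K + 1)) j)) (hrun : ∀ K, RGEqH K β (g K))
    (hbox : ∀ K i, i ≤ K → 0 < g K i ∧ g K i ≤ γ) (hpin : ∀ K, g K K = gIR)
    (hb : 0 < b) (hlo : EventualLowerH b γ k₀ β) (hC₁ : 0 ≤ C₁)
    (hAF1 : ∀ k (p : Fin (k + 1) → ℝ), p ∈ Box γ k → |S.β1 k p| ≤ C₁ * p (Fin.last k))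
    (hconv : Tendsto S.β0 atTop (𝓝 binf)) :
    Tendsto (fun m : ℕ => (m : ℝ) * (gstar g m) ^ 2) atTop (𝓝 (1 / binf)) := by
  have hγ : 0 < γ := by
    have h := hbox 0 0 le_rfl
    exact h.1.trans_le h.2
  have hbinf : binf ≠ 0 := (hb.trans_le (af_le_binf S hγ hlo hAF1 hconv)).ne'
  have h := tendsto_inv_div hbinf (tendsto_astar_div S hθ1 hinj hrun hbox hpin hb hlo hC₁ hAF1 hconv)
  refine (tendsto_congr fun m => ?_).1 h
  rw [← one_div_gstar_sq hθ1 hinj hbox m, one_div (gstar g m ^ 2), div_inv_eq_mul]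

end Continuum

/-! ## §5 The sharper remainder: a quadratic bound on β¹ gives a LOGARITHMIC error (two-loop size) -/

section Quadratic

variable {β : HBeta}

/-- THE LOGARITHMIC SUM OF SQUARED COUPLINGS along a box run: `Σ_{k<K} (gs k)² ≤ k₀γ² + (1 + log K)/b` (profile
`(gs k)² ≤ 1/(b(K−k))` from scale `k₀` on, harmonic comparison `T4CauchySum.sum_range_div_succ_le` BY NAME). [folklore] -/
theorem sum_run_sq_le {γ b : ℝ} {k₀ K : ℕ} {gs : ℕ → ℝ} (h : RGEqH K β gs)
    (hbox : ∀ k, k ≤ K → 0 < gs k ∧ gs k ≤ γ) (hb : 0 < b) (hlo : EventualLowerH b γ k₀ β) :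
    ∑ k ∈ range K, (gs k) ^ 2 ≤ (k₀ : ℝ) * γ ^ 2 + (1 + Real.log K) / b := by
  have hγ : 0 ≤ γ := (hbox K le_rfl).1.le.trans (hbox K le_rfl).2
  rw [← sum_range_reflect (fun k => (gs k) ^ 2) K, ← sum_range_add_sum_Ico _ (Nat.sub_le K k₀)]
  have h1 : ∑ j ∈ range (K - k₀), (gs (K - 1 - j)) ^ 2 ≤ (1 + Real.log K) / b := by
    calc ∑ j ∈ range (K - k₀), (gs (K - 1 - j)) ^ 2
        ≤ ∑ j ∈ range (K - k₀), (1 / b) / ((j : ℝ) + 1) := sum_le_sum fun j hj => by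
          have hj := mem_range.1 hj
          have hk₀ : k₀ ≤ K - 1 - j := by omega
          have hk : K - 1 - j < K := by omega
          have e : ((K - (K - 1 - j) : ℕ) : ℝ) = (j : ℝ) + 1 := by
            have : K - (K - 1 - j) = j + 1 := by omega
            rw [this]; push_cast; ring
          have := run_sq_le_inv h hbox hb hlo hk₀ hk
          rwa [e, ← div_div] at this
      _ ≤ (1 / b) * (1 + Real.log ((K - k₀ : ℕ) : ℝ)) := sum_range_div_succ_le (by positivity) _
      _ ≤ (1 / b) * (1 + Real.log K) := by
          refine mul_le_mul_of_nonneg_left ?_ (by positivity)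
          rcases Nat.eq_zero_or_pos (K - k₀) with h0 | hpos
          · rw [h0]; simp [Real.log_natCast_nonneg]
          · have : Real.log ((K - k₀ : ℕ) : ℝ) ≤ Real.log K :=
              Real.log_le_log (by exact_mod_cast hpos) (by exact_mod_cast Nat.sub_le K k₀)
            linarith
      _ = (1 + Real.log K) / b := by ring
  have h2 : ∑ j ∈ Ico (K - k₀) K, (gs (K - 1 - j)) ^ 2 ≤ (k₀ : ℝ) * γ ^ 2 := by
    calc ∑ j ∈ Ico (K - k₀) K, (gs (K - 1 - j)) ^ 2 ≤ ∑ j ∈ Ico (K - k₀) K, γ ^ 2 :=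
          sum_le_sum fun j hj => by
            have hb' := hbox (K - 1 - j) (by omega)
            exact pow_le_pow_left₀ hb'.1.le hb'.2 2
      _ = ((K - (K - k₀) : ℕ) : ℝ) * γ ^ 2 := by rw [sum_const, Nat.card_Ico, nsmul_eq_mul]
      _ ≤ (k₀ : ℝ) * γ ^ 2 :=
          mul_le_mul_of_nonneg_right (by exact_mod_cast (by omega : K - (K - k₀) ≤ k₀)) (sq_nonneg γ)
  linarith

/-- **THE ONE-LOOP LAW WITH LOGARITHMIC ERROR.**  Under a QUADRATIC remainder bound `|β¹_{k+1}(p)| ≤ C₂·p_k²` on the boxes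
(a BINDER of two-loop SIZE; NOT PRINTED) and `EventualLowerH b γ k₀ β` (`b > 0`):
`|1/(gs 0)² − 1/(gs K)² − Σ_{k<K} β⁰_k| ≤ C₂(k₀γ² + (1 + log K)/b)` — the size of the `(γ₁/γ₀) log log(1/a²)` term of the
two-loop law.  (Contrast `T4BetaMemory.not_injectedRate_harmonicDisc`: a harmonic profile of the two-run DISCREPANCY is
not summable — size control of β¹ does not give the RATE node U2 needs; it gives exactly the asymptotics here.) [folklore] -/
theorem abs_invSq_bare_sub_oneLoop_le_log (S : B12Beta.OneLoopSplit β) {γ b C₂ : ℝ} {k₀ K : ℕ} {gs : ℕ → ℝ}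
    (h : RGEqH K β gs) (hbox : ∀ k, k ≤ K → 0 < gs k ∧ gs k ≤ γ) (hb : 0 < b)
    (hlo : EventualLowerH b γ k₀ β) (hC₂ : 0 ≤ C₂)
    (hAF2 : ∀ k (p : Fin (k + 1) → ℝ), p ∈ Box γ k → |S.β1 k p| ≤ C₂ * p (Fin.last k) ^ 2) :
    |1 / (gs 0) ^ 2 - 1 / (gs K) ^ 2 - ∑ k ∈ range K, S.β0 k| ≤
      C₂ * ((k₀ : ℝ) * γ ^ 2 + (1 + Real.log K) / b) := by
  have e : 1 / (gs 0) ^ 2 - 1 / (gs K) ^ 2 - ∑ k ∈ range K, S.β0 k = ∑ k ∈ range K, S.β1 k (prefixOf gs k) := by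
    rw [invSq_bare_eq_split_sum S h]; ring
  rw [e]
  have h1 : |∑ k ∈ range K, S.β1 k (prefixOf gs k)| ≤ C₂ * ∑ k ∈ range K, (gs k) ^ 2 := by
    rw [mul_sum]
    refine (abs_sum_le_sum_abs _ _).trans (sum_le_sum fun k hk => ?_)
    have hkK : k ≤ K := (mem_range.1 hk).le
    simpa using hAF2 k _ (prefixOf_mem_box hkK hbox)
  exact h1.trans (mul_le_mul_of_nonneg_left (sum_run_sq_le h hbox hb hlo) hC₂)

end Quadratic

/-! ## §6 Sanity: on the constant family the linear law is an identity -/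

/-- On the constant family `β ≡ b` (`b > 0`; gen 8's `backwardWP_const`) with the trivial split `β⁰ ≡ b`, `β¹ ≡ 0` and
all constants `0`, `abs_invSq_bareOf_sub_linear_le` returns the IDENTITY `1/g₀(K)² = 1/g² + K·b`. [folklore] -/
example {γ b x : ℝ} (hγ : 0 < γ) (hb : 0 < b) (hx : 0 < x) (hxγ : x ≤ γ) (K : ℕ) :
    1 / (bareOf (fun _ _ => b) γ K x) ^ 2 = 1 / x ^ 2 + (K : ℝ) * b := by
  let S : B12Beta.OneLoopSplit (fun _ _ => b : HBeta) :=
    { β0 := fun _ => b, β1 := fun _ _ => 0, split := fun _ _ => by simp, vanish := fun _ _ _ => rfl }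
  have hlo : EventualLowerH b γ 0 (fun _ _ => b : HBeta) := fun _ _ _ _ => le_rfl
  have hAF1 : ∀ k (p : Fin (k + 1) → ℝ), p ∈ Box γ k → |S.β1 k p| ≤ 0 * p (Fin.last k) := fun _ _ _ => by simp [S]
  have hconv : ∀ k, |S.β0 k - b| ≤ 0 * (0 : ℝ) ^ k := fun _ => by simp [S]
  have h := abs_invSq_bareOf_sub_linear_le (backwardWP_const hγ hb) S hb hlo le_rfl hAF1 le_rfl zero_lt_one hconv
    K hx hxγ
  have h0 : |1 / (bareOf (fun _ _ => b) γ K x) ^ 2 - 1 / x ^ 2 - (K : ℝ) * b| ≤ 0 := by simpa using h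
  have := abs_nonpos_iff.1 h0
  linarith

/-- … and the product law holds with limit `1/b`. [folklore] -/
example {γ b x : ℝ} (hγ : 0 < γ) (hb : 0 < b) (hx : 0 < x) (hxγ : x ≤ γ) :
    Tendsto (fun K : ℕ => (K : ℝ) * (bareOf (fun _ _ => b) γ K x) ^ 2) atTop (𝓝 (1 / b)) := by
  let S : B12Beta.OneLoopSplit (fun _ _ => b : HBeta) :=
    { β0 := fun _ => b, β1 := fun _ _ => 0, split := fun _ _ => by simp, vanish := fun _ _ _ => rfl }
  have hlo : EventualLowerH b γ 0 (fun _ _ => b : HBeta) := fun _ _ _ _ => le_rfl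
  have hAF1 : ∀ k (p : Fin (k + 1) → ℝ), p ∈ Box γ k → |S.β1 k p| ≤ 0 * p (Fin.last k) := fun _ _ _ => by simp [S]
  have hconv : Tendsto S.β0 atTop (𝓝 b) := tendsto_const_nhds
  exact tendsto_mul_bareOf_sq (backwardWP_const hγ hb) S hb hlo le_rfl hAF1 hconv hx hxγ

end

end Literature.MathematicalPhysics.QuantumFieldTheory.Balaban1983to89.T4OneLoopAsymptotics
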